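import Summits.HodgeConjecture.HodgeConjecture.Theorems.F0P3KitOfRecord   -- (K0): `kitOfRecord` + read-backs
import HarnessLib

/-!
# Crux `H413` — T5 ED. 4, K1: **`𝔠₀ = kitOfRecord …` IS PINNED** — `IsPinned` pin by pin from the ★ tokens of record

PLAN.F0P3g5 §5 K1, RULING (V37)(5): pins (i) ★ `coe_mult_cl_of_frame`, (ii)(iv)(v) ★ `clFinChoice` specs (p819116), (iii) Haar family hypothesis, (vi) ★ `evpChoice_of_not`,
(vii)(viii) ★ `hat₀_factorises`∕`hat₀_rich` (p821235), (ix) ★ `cptTriv₀_cl_iff` (p819716); the exact-ramification pins ((ii)'s guard `v ∉ ramCls c`, and v6's (x)) are read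
through the PARAMETER `ramCls₀` under the hypothesis `hram` (= B-p08 (g20)'s `F0P3RamClsOfRecord.ramCls₀` BY DEFINITION, via ★ `nonempty_and_not_exists_of_not_isSpherical`)
— discharged by `exact` when «RC» is ★; pin (x) enters as the hypothesis `hx` (= «RC»'s `ramCls₀_finite_of_isCot` read through `ramCls₀_rep_cl`).  No `sorry`, no named fact; `--supports stmt-HodgeConjecture-24833 --as helper`.
HONEST LABEL: HC_CM is proved only modulo the printed citations until rung 0 closes.
-/

set_option autoImplicit false
set_option linter.dupNamespace false

noncomputable section

open NumberField IsDedekindDomain MeasureTheory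
open Literature.NumberTheory.Rogawski1990 Literature.NumberTheory.GaloisRepresentations
open Literature.NumberTheory.Automorphic Literature.NumberTheory.Automorphic.UnitaryGroup
open Literature.NumberTheory.Automorphic.UnitaryGroup.CotangentForms
open scoped Matrix ComplexOrder

namespace Summit.HodgeConjecture.HodgeConjecture.Cruxes.H413.F0P3KitOfRecord

open Summit.HodgeConjecture.HodgeConjecture.Cruxes.H413.F0P3InnerFormClassificationV6
open Summit.HodgeConjecture.HodgeConjecture.Cruxes.H413.F0P3ClassTokensOfRecord (Cls cl rep mult)
open Summit.HodgeConjecture.HodgeConjecture.Cruxes.H413.F0P3ClassTokenChoice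
open Summit.HodgeConjecture.HodgeConjecture.Cruxes.H413.F0P3CompactTrivOfRecord (cptTriv₀ cptTriv₀_cl_iff)
open Summit.HodgeConjecture.HodgeConjecture.Cruxes.H413.F0P3TestFunctionsOfRecord (Unr₀ hat₀ hat₀_factorises hat₀_rich)
open Summit.HodgeConjecture.HodgeConjecture.Cruxes.H413.F0P3SemilocalTestFunctionsOfRecord (TestS₀)

variable (L : Type) [Field L] [NumberField L] [IsCMField L] (H : Matrix (Fin 3) (Fin 3) L) (ι : L →+* ℂ) (T : GL (Fin 3) ℂ)
  (hT : (T : Matrix (Fin 3) (Fin 3) ℂ)ᴴ * H.map ι * (T : Matrix (Fin 3) (Fin 3) ℂ) = Literature.Geometry.ComplexHyperbolic.BallModel.J)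
  (μ : Measure (Gp L H).automorphicQuotient) [(Gp L H).IsAutomorphicMeasure μ]
  [MeasurableSpace (Gp L H).Adelic] [BorelSpace (Gp L H).Adelic]
  (𝔰 : Sockets L H μ) (gh : GHSide L H ι T hT 𝔰.PacketG 𝔰.PacketH) (ξd : XiSide L H 𝔰.PacketG 𝔰.PacketH)
  (μω : HeckeCharacter L) (c : ℚ) (jInf dsInf : ℤ → ℤ → ℤ → Cinf)
  (archTr : Cinf → (UnitaryGroup.arch (↥(maximalRealSubfield L)) L (IsCMField.complexConj L) 3 H → ℂ) → ℂ)
  (ν : Measure (Gp L H).Adelic) [IsFiniteMeasureOnCompacts ν]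
  (μv : ∀ v : Places L, @Measure ((cmDatum L 3 H).Local v) (borel _))
  (ramCls₀ : DiscreteAutomorphicRep (Gp L H) μ → Set (Places L))

/-- **K1: the kit of record is PINNED** (★ V6-A `IsPinned` (i)–(x); (x) is the hypothesis `hx`).  Hypotheses: the compact CM frame (`hdef`, `h2` — pin (i) via ★
`coe_mult_cl_of_frame`), the Haar family `hμv` (pin (iii)), and `hram` («off `ramCls₀ P` the chosen local class is `K_v`-spherical» — by definition for B-p08's `ramCls₀`,
★ `nonempty_and_not_exists_of_not_isSpherical`).  [cite: Rogawski1990, §14.5 p. 237; §13.7 p. 206] [cite: CartierCorvallis1979, §IV.1 Cor. 4.1] [cite: FlathCorvallis1979, Thm. 3] -/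
theorem isPinned_kitOfRecord
    (hdef : ∀ τ' : L →+* ℂ, InfinitePlace.mk τ' ≠ InfinitePlace.mk ι → (H.map τ').PosDef) (h2 : 2 ≤ Module.finrank ℚ ↥(maximalRealSubfield L))
    (hμv : ∀ v : Places L, letI : MeasurableSpace ((cmDatum L 3 H).Local v) := borel _; (μv v).IsHaarMeasure)
    (hram : ∀ (P : DiscreteAutomorphicRep (Gp L H) μ) (v : Places L),
      ¬ (clFinChoice P v).IsSpherical (cmLocalIntegralLevel L 3 H v) → v ∈ ramCls₀ P)
    (hx : ∀ P : DiscreteAutomorphicRep (Gp L H) μ, IsCot L H ι T hT μ P → KcTrivial L H ι T hT μ P →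
      (ramCls₀ (rep (Gp L H) μ (cl (Gp L H) μ P))).Finite) :
    (kitOfRecord L H ι T hT μ 𝔰 gh ξd μω c jInf dsInf archTr ν μv ramCls₀).IsPinned := by
  refine ⟨?_, ?_, ?_, ?_, ?_, ?_, ?_, ?_, ?_, ?_⟩
  · -- (i) multiplicity ★ `coe_mult_cl_of_frame` (compact quotient); `cmDatum L 3 H = Gp L H` instance transport
    intro P
    haveI : (cmDatum L 3 H).IsAutomorphicMeasure μ := ‹(Gp L H).IsAutomorphicMeasure μ›
    exact F0P3ClassTokensOfRecord.coe_mult_cl_of_frame L ι H hdef h2 μ P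
  · -- (ii) D9 pin: off `ramCls₀ (rep c)` the chosen class is spherical with the chosen e.v.p.
    intro x v hv
    exact isSphericalWith_evpChoice_of_isSpherical (rep (Gp L H) μ x) v (μv v) (hμv v) (not_not.1 fun h => hv (hram _ v h))
  · -- (iii) Haar
    exact hμv
  · -- (iv) admissibility (UNCONDITIONAL ★)
    intro x v _
    exact clFinChoice_isAdmissible (rep (Gp L H) μ x) v
  · -- (v) unitarizability (UNCONDITIONAL ★)
    intro x v _
    exact clFinChoice_isUnitarizable (rep (Gp L H) μ x) v
  · -- (vi) junk convention ★ `evpChoice_of_not`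
    intro x v f hf
    exact evpChoice_of_not (rep (Gp L H) μ x) v (μv v) hf
  · -- (vii) `hat₀` factorises ★
    exact hat₀_factorises L H
  · -- (viii) `Unr₀` is rich ★
    exact hat₀_rich L H
  · -- (ix) `Kc`-triviality ★ `cptTriv₀_cl_iff`
    intro P hP
    exact (cptTriv₀_cl_iff L ι H T hT μ P).2 hP
  · -- (x) (v6) exact-ramification cofiniteness for cotangent-type `Kc`-trivial `P` — hypothesis `hx` (B-p08 (g20) «RC»: `ramCls₀_finite_of_isCot` ∘ `ramCls₀_rep_cl`)
    exact hx

end Summit.HodgeConjecture.HodgeConjecture.Cruxes.H413.F0P3KitOfRecord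

end
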